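import Summits.QuantumFields.YangMills.Theorems.SwapVirialDeficitZeroModeThreeScaling
import HarnessLib

/-!
# The `k = 3` zero-mode block is REGULAR, II: the uniform bound `β²·Z₃(β) ≤ B₃ < ∞`
# (free-hands support of crux ⟨stmt-QuantumFields-24197⟩ `SwapVirialDeficit.SwapGluedStiffness`, LINE «sharp-sigma»; companion of file I
# ✓`SwapVirialDeficitZeroModeThreeScaling`)

Symmetrisation over the largest of the three columns (`∫F₃ ≤ 3∫𝟙_{‖c_μ‖≤‖c₂‖}F₃ = 3∫Φ⁺₃(β,a)da`, column permutations are measure preserving),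
rotation `a ↦ ‖a‖e₃`, and on the box `‖x_μ‖ ≤ r` the `r`-DEPENDENT rescaling `diag(1/(r√β), 1/(r√β), r)` of the two remaining columns
(determinant `(rβ)⁻²`) after dropping the planar Gram square and the Gaussian of `x`: the image is the `β`- and `r`-free kernel
`κ₂ = 𝟙_{|y_μ2|≤1}·exp(−plSq y₀ − plSq y₁ − cr(y₀,y₁))` with `K₂ = ∫κ₂ ≤ e²∫gaussW < ∞`, so `Φ⁺₃(β, re₃) ≤ e^{−r²/2}K₂/(rβ)²` and, radially
(`∫_{ℝ³} e^{−‖a‖²/2}‖a‖⁻² da = 3vol(B₁)∫₀^∞e^{−r²/2}dr < ∞` — the `k = 3` profile `r²·r⁻²` is INTEGRABLE at `0`, where the `k = 4` profile `r²·r⁻³`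
gave the logarithm): ★★ `zeroModeZ_three_sq_mul_le`: `β²·Z₃(β) ≤ B₃` for every `β > 0`, with `B₃ < ∞` explicit as a lower integral.

HONEST LABEL: finite-dimensional Laplace analysis toward a plan-level zero-mode rung of the DRAFT line «sharp-sigma»; not the fixed-`L` sharp law, not
⟨24197⟩/⟨24194⟩, no rung / summit statement; the Yang–Mills mass gap is NOT proved; no summit is proved by a line.  Width seat ym-line-sfw-p2-w3 g62
(cell ym-idea-1, free hands), `--supports stmt-QuantumFields-24197`.  Standard axioms, 0 `sorry`.  References: [cite: tHooft1979]; [cite: Vanbaal2001]; [folklore].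
-/

set_option autoImplicit false

noncomputable section

namespace Summit.QuantumFields.YangMills.Theorems.ToronValleyVolume.ZeroMode

open MeasureTheory Real Finset Set Filter
open scoped ENNReal Topology
open Summit.QuantumFields.YangMills.Cruxes.ToronTubeVolumeLaw.Birth

/-! ## §5 Symmetrisation over the largest of the three columns (upper half) -/

/-- The `ℝ≥0∞`-valued integrand of `Z₃(β)`. -/
def F3 (β : ℝ) (c : Fin 3 → EuclideanSpace ℝ (Fin 3)) : ℝ≥0∞ := ENNReal.ofReal (zmI 3 β c)

/-- `F3` is measurable. [folklore] -/
theorem measurable_F3 (β : ℝ) : Measurable (F3 β) := ENNReal.measurable_ofReal.comp (measurable_zmI 3 β)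

/-- Column `ν` is (weakly) the largest of the three. -/
def Bmax3 (ν : Fin 3) : Set (Fin 3 → EuclideanSpace ℝ (Fin 3)) := {c | ∀ μ, ‖c μ‖ ≤ ‖c ν‖}

/-- `Bmax3 ν` is measurable (closed). [folklore] -/
theorem measurableSet_Bmax3 (ν : Fin 3) : MeasurableSet (Bmax3 ν) := by
  have : Bmax3 ν = ⋂ μ, {c : Fin 3 → EuclideanSpace ℝ (Fin 3) | ‖c μ‖ ≤ ‖c ν‖} := by
    ext c; simp [Bmax3]
  rw [this]
  exact MeasurableSet.iInter fun μ =>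
    measurableSet_le (continuous_norm.comp (continuous_apply μ)).measurable
      (continuous_norm.comp (continuous_apply ν)).measurable

/-- Pointwise: `F₃ ≤ Σ_ν 𝟙_{Bmax3 ν} F₃` (some column is the largest). [folklore] -/
theorem F3_le_sum_indicator_Bmax3 (β : ℝ) (c : Fin 3 → EuclideanSpace ℝ (Fin 3)) :
    F3 β c ≤ ∑ ν, (Bmax3 ν).indicator (F3 β) c := by
  obtain ⟨ν₀, -, hν₀⟩ := Finset.exists_max_image Finset.univ (fun μ => ‖c μ‖) Finset.univ_nonempty
  have hmem : c ∈ Bmax3 ν₀ := fun μ => hν₀ μ (Finset.mem_univ μ)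
  calc F3 β c = (Bmax3 ν₀).indicator (F3 β) c := (indicator_of_mem hmem _).symm
    _ ≤ ∑ ν, (Bmax3 ν).indicator (F3 β) c :=
        Finset.single_le_sum (f := fun ν => (Bmax3 ν).indicator (F3 β) c) (fun ν _ => zero_le) (Finset.mem_univ ν₀)

/-- The coordinate permutation `c ↦ c ∘ σ` is a measure-preserving map of `(ℝ³)³`. [folklore] -/
theorem measurePreserving_comp_perm3 (σ : Equiv.Perm (Fin 3)) :
    MeasurePreserving (fun c : Fin 3 → EuclideanSpace ℝ (Fin 3) => c ∘ σ) volume volume := by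
  have h := volume_measurePreserving_piCongrLeft (fun _ : Fin 3 => EuclideanSpace ℝ (Fin 3)) σ.symm
  have hfun : (fun c : Fin 3 → EuclideanSpace ℝ (Fin 3) => c ∘ σ) =
      ⇑(MeasurableEquiv.piCongrLeft (fun _ : Fin 3 => EuclideanSpace ℝ (Fin 3)) σ.symm) := by
    funext c; funext i
    simp [MeasurableEquiv.coe_piCongrLeft, Equiv.piCongrLeft_apply_eq_cast]
  rw [hfun]; exact h

/-- Transport of `∫ 𝟙_{Bmax3 ν} F₃` to `ν = 2` by the transposition `(ν 2)` of the columns. [folklore] -/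
theorem lintegral_indicator_Bmax3 (β : ℝ) (ν : Fin 3) :
    ∫⁻ c, (Bmax3 ν).indicator (F3 β) c = ∫⁻ c, (Bmax3 2).indicator (F3 β) c := by
  have hmp := measurePreserving_comp_perm3 (Equiv.swap ν 2)
  have hmeas : Measurable ((Bmax3 2).indicator (F3 β)) := (measurable_F3 β).indicator (measurableSet_Bmax3 2)
  have hS : ∀ c : Fin 3 → EuclideanSpace ℝ (Fin 3), c ∘ (Equiv.swap ν 2) ∈ Bmax3 2 ↔ c ∈ Bmax3 ν := by
    intro c
    simp only [Bmax3, Set.mem_setOf_eq, Function.comp_apply, Equiv.swap_apply_right]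
    constructor
    · intro h μ; simpa using h (Equiv.swap ν 2 μ)
    · intro h μ; exact h _
  rw [← hmp.lintegral_comp hmeas]
  refine lintegral_congr fun c => ?_
  by_cases hc : c ∈ Bmax3 ν
  · rw [indicator_of_mem hc, indicator_of_mem ((hS c).2 hc)]
    unfold F3; rw [zmI_perm]
  · rw [indicator_of_notMem hc, indicator_of_notMem (fun h => hc ((hS c).1 h))]

/-- UPPER symmetrisation: `∫ F₃ ≤ 3 · ∫ 𝟙_{Bmax3 2} F₃`. [folklore] -/
theorem lintegral_F3_le_three_Bmax3 (β : ℝ) :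
    ∫⁻ c, F3 β c ≤ 3 * ∫⁻ c, (Bmax3 2).indicator (F3 β) c := by
  calc ∫⁻ c, F3 β c ≤ ∫⁻ c, ∑ ν, (Bmax3 ν).indicator (F3 β) c := lintegral_mono (F3_le_sum_indicator_Bmax3 β)
    _ = ∑ ν, ∫⁻ c, (Bmax3 ν).indicator (F3 β) c :=
        lintegral_finsetSum _ fun ν _ => (measurable_F3 β).indicator (measurableSet_Bmax3 ν)
    _ = ∑ ν : Fin 3, ∫⁻ c, (Bmax3 2).indicator (F3 β) c := Finset.sum_congr rfl fun ν _ => lintegral_indicator_Bmax3 β ν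
    _ = 3 * ∫⁻ c, (Bmax3 2).indicator (F3 β) c := by simp

/-! ## §6 The box-restricted conditional integral `Φ⁺₃` and its rotation invariance -/

/-- The two remaining columns lie in the closed ball of radius `‖a‖`. -/
def boxLe2 (a : EuclideanSpace ℝ (Fin 3)) : Set (Fin 2 → EuclideanSpace ℝ (Fin 3)) := {x | ∀ μ, ‖x μ‖ ≤ ‖a‖}

/-- `boxLe2 a` is measurable. [folklore] -/
theorem measurableSet_boxLe2 (a : EuclideanSpace ℝ (Fin 3)) : MeasurableSet (boxLe2 a) := by
  have : boxLe2 a = ⋂ μ, {x : Fin 2 → EuclideanSpace ℝ (Fin 3) | ‖x μ‖ ≤ ‖a‖} := by ext x; simp [boxLe2]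
  rw [this]
  exact MeasurableSet.iInter fun μ =>
    measurableSet_le (continuous_norm.comp (continuous_apply μ)).measurable measurable_const

/-- The box-restricted integrand `𝟙_{boxLe2 a}(x)·exp(−βQ₃(x,a) − (‖x‖²+‖a‖²)/2)`. -/
def G3 (β : ℝ) (a : EuclideanSpace ℝ (Fin 3)) (x : Fin 2 → EuclideanSpace ℝ (Fin 3)) : ℝ≥0∞ :=
  (boxLe2 a).indicator (fun x => ENNReal.ofReal (zmI 3 β (Fin.snoc x a))) x

/-- UPPER conditional integral `Φ⁺₃(β,a) = ∫_{‖x_μ‖ ≤ ‖a‖} exp(−βQ₃(x,a) − (‖x‖²+‖a‖²)/2) dx`. -/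
def PhiP3 (β : ℝ) (a : EuclideanSpace ℝ (Fin 3)) : ℝ≥0∞ := ∫⁻ x, G3 β a x

/-- Measurability of `x ↦ exp(−βQ₃(x,a) − …)` for fixed `a`. [folklore] -/
theorem measurable_zmI_three_snoc (β : ℝ) (a : EuclideanSpace ℝ (Fin 3)) :
    Measurable (fun x : Fin 2 → EuclideanSpace ℝ (Fin 3) => ENNReal.ofReal (zmI 3 β (Fin.snoc x a))) :=
  ENNReal.measurable_ofReal.comp ((measurable_zmI 3 β).comp (measurable_snoc2_pair.comp
    (measurable_const.prodMk measurable_id)))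

/-- `G3 β a` is measurable. [folklore] -/
theorem measurable_G3 (β : ℝ) (a : EuclideanSpace ℝ (Fin 3)) : Measurable (G3 β a) :=
  (measurable_zmI_three_snoc β a).indicator (measurableSet_boxLe2 a)

/-- `snoc x a` has weakly largest last column iff `x ∈ boxLe2 a`. [folklore] -/
theorem snoc_mem_Bmax3_iff (x : Fin 2 → EuclideanSpace ℝ (Fin 3)) (a : EuclideanSpace ℝ (Fin 3)) :
    (Fin.snoc x a : Fin 3 → EuclideanSpace ℝ (Fin 3)) ∈ Bmax3 2 ↔ x ∈ boxLe2 a := by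
  have h3 : (Fin.snoc x a : Fin 3 → EuclideanSpace ℝ (Fin 3)) (Fin.last 2) = a := Fin.snoc_last _ _
  simp only [Bmax3, boxLe2, Set.mem_setOf_eq]
  rw [Fin.forall_fin_succ', show (2 : Fin 3) = Fin.last 2 from rfl, h3]
  simp only [Fin.snoc_castSucc, le_refl, and_true]

/-- The symmetrised integral is `∫ Φ⁺₃(β,a) da`. [folklore] -/
theorem lintegral_Bmax3_eq (β : ℝ) : ∫⁻ c, (Bmax3 2).indicator (F3 β) c = ∫⁻ a, PhiP3 β a := by
  rw [lintegral_eq_lintegral_snoc2 _ ((measurable_F3 β).indicator (measurableSet_Bmax3 2))]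
  refine lintegral_congr fun a => lintegral_congr fun x => ?_
  unfold G3
  by_cases hx : x ∈ boxLe2 a
  · rw [indicator_of_mem ((snoc_mem_Bmax3_iff x a).2 hx), indicator_of_mem hx]; rfl
  · rw [indicator_of_notMem (fun h => hx ((snoc_mem_Bmax3_iff x a).1 h)), indicator_of_notMem hx]

/-- ★ UPPER reduction: `∫ F₃ ≤ 3 ∫ Φ⁺₃(β,a) da`. [folklore] -/
theorem lintegral_F3_le_three_PhiP3 (β : ℝ) : ∫⁻ c, F3 β c ≤ 3 * ∫⁻ a, PhiP3 β a := by
  rw [← lintegral_Bmax3_eq]; exact lintegral_F3_le_three_Bmax3 β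

/-- ROTATION INVARIANCE of `Φ⁺₃`. [folklore] -/
theorem PhiP3_map (β : ℝ) (R : EuclideanSpace ℝ (Fin 3) ≃ₗᵢ[ℝ] EuclideanSpace ℝ (Fin 3)) (a : EuclideanSpace ℝ (Fin 3)) :
    PhiP3 β a = PhiP3 β (R a) := by
  unfold PhiP3
  rw [← (measurePreserving_columns2 R).lintegral_comp (measurable_G3 β (R a))]
  refine lintegral_congr fun x => ?_
  have hmem : (fun μ => R (x μ)) ∈ boxLe2 (R a) ↔ x ∈ boxLe2 a := by simp [boxLe2, R.norm_map]
  unfold G3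
  by_cases hx : x ∈ boxLe2 a
  · rw [indicator_of_mem hx, indicator_of_mem (hmem.2 hx)]
    rw [show (Fin.snoc (fun μ => R (x μ)) (R a) : Fin 3 → EuclideanSpace ℝ (Fin 3)) =
        fun μ => R ((Fin.snoc x a : Fin 3 → EuclideanSpace ℝ (Fin 3)) μ) from (Fin.comp_snoc R x a).symm,
      zmI_map]
  · rw [indicator_of_notMem hx, indicator_of_notMem (fun h => hx (hmem.1 h))]

/-- `Φ⁺₃(β,a) = Φ⁺₃(β, ‖a‖e₃)`. [folklore] -/
theorem PhiP3_eq_axis (β : ℝ) (a : EuclideanSpace ℝ (Fin 3)) : PhiP3 β a = PhiP3 β (‖a‖ • e3) := by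
  obtain ⟨R, hR⟩ := exists_isometry_map_eq_smul_e3 a
  rw [PhiP3_map β R a, hR]

/-! ## §7 The box bound on the axis: the `β`- and `r`-free kernel `κ₂` -/

/-- The two-column slab `|y_μ,2| ≤ 1`. -/
def slab2 : Set (Fin 2 → EuclideanSpace ℝ (Fin 3)) := {y | ∀ μ, |y μ 2| ≤ 1}

/-- `slab2` is measurable. [folklore] -/
theorem measurableSet_slab2 : MeasurableSet slab2 := by
  have : slab2 = ⋂ μ, {y : Fin 2 → EuclideanSpace ℝ (Fin 3) | |y μ 2| ≤ 1} := by ext y; simp [slab2]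
  rw [this]
  refine MeasurableSet.iInter fun μ => measurableSet_le ?_ measurable_const
  exact (continuous_abs.comp ((EuclideanSpace.proj (2 : Fin 3)).continuous.comp (continuous_apply μ))).measurable

/-- The real two-column kernel `exp(−plSq y₀ − plSq y₁ − cr(y₀,y₁))`. -/
def ker2R (y : Fin 2 → EuclideanSpace ℝ (Fin 3)) : ℝ := Real.exp (-(plSq (y 0) + plSq (y 1)) - cr (y 0) (y 1))

/-- Auxiliary: `continuous_ker2R`. [folklore] -/
theorem continuous_ker2R : Continuous ker2R := by unfold ker2R plSq cr; fun_prop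

/-- THE KERNEL `κ₂ = 𝟙_{slab2}·exp(−plSq y₀ − plSq y₁ − cr(y₀,y₁))` (`β`- and `r`-free). -/
def kappa2 (y : Fin 2 → EuclideanSpace ℝ (Fin 3)) : ℝ≥0∞ := slab2.indicator (fun y => ENNReal.ofReal (ker2R y)) y

/-- Auxiliary: `measurable_kappa2`. [folklore] -/
theorem measurable_kappa2 : Measurable kappa2 :=
  (ENNReal.measurable_ofReal.comp continuous_ker2R.measurable).indicator measurableSet_slab2

/-- `K₂ = ∫ κ₂`. -/
def KK2 : ℝ≥0∞ := ∫⁻ y, kappa2 y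

/-- `K₂ < ∞`: on the slab `κ₂ ≤ e²·Π_μ exp(−‖y_μ‖²/2)`. [folklore] -/
theorem KK2_lt_top : KK2 < ⊤ := by
  have hbound : ∀ y, kappa2 y ≤ ENNReal.ofReal (Real.exp 2 * gaussW 2 y) := by
    intro y
    unfold kappa2
    by_cases hy : y ∈ slab2
    · rw [indicator_of_mem hy]
      refine ENNReal.ofReal_le_ofReal ?_
      unfold ker2R
      rw [gaussW_eq_exp, ← Real.exp_add, Fin.sum_univ_two]
      refine Real.exp_le_exp.2 ?_
      have hc := cr_nonneg (y 0) (y 1)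
      have h0 : plSq (y 0) ≥ ‖y 0‖ ^ 2 - 1 := by
        rw [normSq_eq_plSq_add]; have := abs_le.1 (hy 0); nlinarith
      have h1 : plSq (y 1) ≥ ‖y 1‖ ^ 2 - 1 := by
        rw [normSq_eq_plSq_add]; have := abs_le.1 (hy 1); nlinarith
      nlinarith [sq_nonneg ‖y 0‖, sq_nonneg ‖y 1‖]
    · rw [indicator_of_notMem hy]; exact zero_le
  have hint : ∫⁻ y, ENNReal.ofReal (Real.exp 2 * gaussW 2 y) < ⊤ := by
    have hi := (integrable_gaussW 2).const_mul (Real.exp 2)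
    exact (hasFiniteIntegral_iff_ofReal (Filter.Eventually.of_forall fun y =>
      mul_nonneg (Real.exp_pos _).le (gaussW_pos 2 y).le)).1 hi.hasFiniteIntegral
  exact lt_of_le_of_lt (lintegral_mono hbound) hint

/-- Auxiliary: `KK2_ne_top`. [folklore] -/
theorem KK2_ne_top : KK2 ≠ ⊤ := KK2_lt_top.ne

/-- POINTWISE box bound on the axis (`r > 0`, `β > 0`): with `Λ = diag(1/(r√β),1/(r√β),r)` on both columns,
`G₃(β, re₃)(Λy) ≤ e^{−r²/2}·κ₂(y)` (drop the planar Gram square and the Gaussian of `x`; the box `‖x_μ‖ ≤ r` forces `|y_μ,2| ≤ 1`). [folklore] -/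
theorem G3_Lam2_le {β r : ℝ} (hβ : 0 < β) (hr : 0 < r) (y : Fin 2 → EuclideanSpace ℝ (Fin 3)) :
    G3 β (r • e3) (Lam2 (r * Real.sqrt β)⁻¹ r y) ≤ ENNReal.ofReal (Real.exp (-r ^ 2 / 2)) * kappa2 y := by
  unfold G3 kappa2
  by_cases hx : Lam2 (r * Real.sqrt β)⁻¹ r y ∈ boxLe2 (r • e3)
  · -- the box forces the slab
    have hy : y ∈ slab2 := by
      intro μ
      have h1 : ‖(Lam2 (r * Real.sqrt β)⁻¹ r y) μ‖ ≤ ‖r • e3‖ := hx μ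
      rw [norm_smul, norm_e3, mul_one, Real.norm_eq_abs, abs_of_pos hr] at h1
      have h2 : |(Lam2 (r * Real.sqrt β)⁻¹ r y) μ 2| ≤ r := (abs_coord_le_norm _ 2).trans h1
      rw [Lam2_apply, diag3_apply_two, abs_mul, abs_of_pos hr] at h2
      exact le_of_mul_le_mul_left (by linarith) hr
    rw [indicator_of_mem hx, indicator_of_mem hy, ← ENNReal.ofReal_mul (Real.exp_pos _).le]
    refine ENNReal.ofReal_le_ofReal ?_
    unfold ker2R
    rw [← Real.exp_add, zmI_three_snoc, sum_two_pd_smul_e3,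
      show ‖r • e3‖ ^ 2 = r ^ 2 by rw [norm_smul, norm_e3, mul_one, Real.norm_eq_abs, sq_abs]]
    refine Real.exp_le_exp.2 ?_
    simp only [Lam2_apply, plSq_diag3]
    have hcr : cr (diag3 (r * Real.sqrt β)⁻¹ r (y 0)) (diag3 (r * Real.sqrt β)⁻¹ r (y 1)) ≤
        pd (diag3 (r * Real.sqrt β)⁻¹ r (y 0)) (diag3 (r * Real.sqrt β)⁻¹ r (y 1)) := cr_le_pd _ _
    rw [cr_diag3] at hcr
    have hs2 : ((r * Real.sqrt β)⁻¹) ^ 2 = (r ^ 2 * β)⁻¹ := by rw [inv_pow, mul_pow, Real.sq_sqrt hβ.le]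
    rw [hs2] at hcr ⊢
    have hn : 0 ≤ ∑ μ : Fin 2, ‖diag3 (r * Real.sqrt β)⁻¹ r (y μ)‖ ^ 2 := Finset.sum_nonneg fun μ _ => sq_nonneg _
    have hrβ : r ^ 2 * β ≠ 0 := by positivity
    have e1 : β * ((r ^ 2 * β)⁻¹ * r ^ 2 * cr (y 0) (y 1)) = cr (y 0) (y 1) := by field_simp
    have e2 : β * (r ^ 2 * ((r ^ 2 * β)⁻¹ * plSq (y 0) + (r ^ 2 * β)⁻¹ * plSq (y 1))) = plSq (y 0) + plSq (y 1) := by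
      field_simp
    nlinarith [e1, e2, hcr, hn, hβ]
  · rw [indicator_of_notMem hx]; exact zero_le

/-- ★ COLUMN BOUND: `Φ⁺₃(β, re₃) ≤ e^{−r²/2}·K₂·(rβ)⁻²` … stated as `(rβ)²·Φ⁺₃ ≤ e^{−r²/2}K₂` (`r, β > 0`). [folklore] -/
theorem PhiP3_axis_le {β r : ℝ} (hβ : 0 < β) (hr : 0 < r) :
    ENNReal.ofReal ((r * β) ^ 2) * PhiP3 β (r • e3) ≤ ENNReal.ofReal (Real.exp (-r ^ 2 / 2)) * KK2 := by
  have hs : (r * Real.sqrt β)⁻¹ ≠ 0 := inv_ne_zero (mul_pos hr (Real.sqrt_pos.2 hβ)).ne'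
  have h := lintegral_comp_Lam2 hs hr.ne' _ (measurable_G3 β (r • e3))
  have hdet : |((r * Real.sqrt β)⁻¹ * (r * Real.sqrt β)⁻¹ * r) ^ 2|⁻¹ = (r * β) ^ 2 := by
    rw [← mul_inv, show r * Real.sqrt β * (r * Real.sqrt β) = r * r * (Real.sqrt β * Real.sqrt β) by ring,
      Real.mul_self_sqrt hβ.le, abs_of_nonneg (sq_nonneg _), ← inv_pow, mul_inv, inv_inv]
    congr 1; field_simp
  unfold PhiP3
  rw [← hdet, ← h]
  calc ∫⁻ y, G3 β (r • e3) (Lam2 (r * Real.sqrt β)⁻¹ r y) ≤ ∫⁻ y, ENNReal.ofReal (Real.exp (-r ^ 2 / 2)) * kappa2 y :=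
        lintegral_mono fun y => G3_Lam2_le hβ hr y
    _ = ENNReal.ofReal (Real.exp (-r ^ 2 / 2)) * KK2 := by
        unfold KK2; rw [lintegral_const_mul _ measurable_kappa2]

/-! ## §8 Radial assembly: `β²·Z₃(β) ≤ B₃ < ∞` -/

/-- The radial weight `∫_{ℝ³} e^{−‖a‖²/2}‖a‖⁻² da` as a lower integral. -/
def Wrad : ℝ≥0∞ := ∫⁻ a : EuclideanSpace ℝ (Fin 3), ENNReal.ofReal (Real.exp (-‖a‖ ^ 2 / 2) / ‖a‖ ^ 2)

/-- `∫_{ℝ³} e^{−‖a‖²/2}‖a‖⁻² da < ∞` — the `k = 3` radial profile `r²·r⁻²` is integrable at the origin (no logarithm). [folklore] -/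
theorem Wrad_lt_top : Wrad < ⊤ := by
  unfold Wrad
  have hmeas : Measurable fun r : ℝ => ENNReal.ofReal (Real.exp (-r ^ 2 / 2) / r ^ 2) :=
    ENNReal.measurable_ofReal.comp (by fun_prop)
  rw [show (fun a : EuclideanSpace ℝ (Fin 3) => ENNReal.ofReal (Real.exp (-‖a‖ ^ 2 / 2) / ‖a‖ ^ 2)) =
      fun a => (fun r : ℝ => ENNReal.ofReal (Real.exp (-r ^ 2 / 2) / r ^ 2)) ‖a‖ from rfl,
    lintegral_radial _ hmeas]
  have hpt : ∀ r ∈ Ioi (0 : ℝ), ENNReal.ofReal (r ^ 2) * ENNReal.ofReal (Real.exp (-r ^ 2 / 2) / r ^ 2) =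
      ENNReal.ofReal (Real.exp (-(1 / 2) * r ^ 2)) := by
    intro r hr
    rw [Set.mem_Ioi] at hr
    rw [← ENNReal.ofReal_mul (sq_nonneg _)]
    congr 1
    field_simp
  rw [setLIntegral_congr_fun measurableSet_Ioi hpt]
  have hfin : ∫⁻ r in Ioi (0 : ℝ), ENNReal.ofReal (Real.exp (-(1 / 2) * r ^ 2)) < ⊤ := by
    refine lt_of_le_of_lt (setLIntegral_le_lintegral _ _) ?_
    have hi := integrable_exp_neg_mul_sq (b := (1 / 2 : ℝ)) (by norm_num)
    exact (hasFiniteIntegral_iff_ofReal (Filter.Eventually.of_forall fun r => (Real.exp_pos _).le)).1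
      hi.hasFiniteIntegral
  refine ENNReal.mul_lt_top (ENNReal.mul_lt_top (by simp) ?_) hfin
  exact measure_ball_lt_top

/-- THE CONSTANT `B₃ = 3·K₂·∫_{ℝ³} e^{−‖a‖²/2}‖a‖⁻² da` (as an extended real; finite by `B3_lt_top`). -/
def B3 : ℝ≥0∞ := 3 * KK2 * Wrad

/-- `B₃ < ∞`. [folklore] -/
theorem B3_lt_top : B3 < ⊤ := by
  unfold B3
  exact ENNReal.mul_lt_top (ENNReal.mul_lt_top (by simp) KK2_lt_top) Wrad_lt_top

/-- ★★ **UNIFORM BOUND**: `β²·Z₃(β) ≤ B₃` for every `β > 0` (lower-integral form). [folklore] -/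
theorem ofReal_sq_mul_zeroModeZ_three_le {β : ℝ} (hβ : 0 < β) : ENNReal.ofReal (β ^ 2 * zeroModeZ 3 β) ≤ B3 := by
  have hae : ∀ᵐ a : EuclideanSpace ℝ (Fin 3) ∂volume, a ≠ 0 := ae_iff.2 (by simp)
  -- pointwise (a.e.) column bound, with `β²` cancelled against `(rβ)⁻²`
  have hpt : ∀ᵐ a : EuclideanSpace ℝ (Fin 3) ∂volume,
      ENNReal.ofReal (β ^ 2) * PhiP3 β (‖a‖ • e3) ≤ KK2 * ENNReal.ofReal (Real.exp (-‖a‖ ^ 2 / 2) / ‖a‖ ^ 2) := by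
    filter_upwards [hae] with a ha
    have hr : 0 < ‖a‖ := norm_pos_iff.2 ha
    have h := PhiP3_axis_le hβ hr
    have hr2 : ENNReal.ofReal (‖a‖ ^ 2) ≠ 0 := (ENNReal.ofReal_pos.2 (by positivity)).ne'
    have hr2' : ENNReal.ofReal (‖a‖ ^ 2) ≠ ⊤ := ENNReal.ofReal_ne_top
    -- multiply the column bound by `‖a‖⁻²`
    have h2 : ENNReal.ofReal (β ^ 2) * PhiP3 β (‖a‖ • e3) =
        (ENNReal.ofReal (‖a‖ ^ 2))⁻¹ * (ENNReal.ofReal ((‖a‖ * β) ^ 2) * PhiP3 β (‖a‖ • e3)) := by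
      rw [mul_pow, ENNReal.ofReal_mul (sq_nonneg _), ← mul_assoc, ← mul_assoc, ENNReal.inv_mul_cancel hr2 hr2', one_mul]
    rw [h2]
    calc (ENNReal.ofReal (‖a‖ ^ 2))⁻¹ * (ENNReal.ofReal ((‖a‖ * β) ^ 2) * PhiP3 β (‖a‖ • e3))
        ≤ (ENNReal.ofReal (‖a‖ ^ 2))⁻¹ * (ENNReal.ofReal (Real.exp (-‖a‖ ^ 2 / 2)) * KK2) := by gcongr
      _ = KK2 * ENNReal.ofReal (Real.exp (-‖a‖ ^ 2 / 2) / ‖a‖ ^ 2) := by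
          rw [ENNReal.ofReal_div_of_pos (by positivity), ENNReal.div_eq_inv_mul, mul_comm KK2, mul_assoc]
  have hF3 : ∫⁻ c, ENNReal.ofReal (zmI 3 β c) ≤ 3 * ∫⁻ a, PhiP3 β a := lintegral_F3_le_three_PhiP3 β
  have hax : (∫⁻ a, PhiP3 β a) = ∫⁻ a : EuclideanSpace ℝ (Fin 3), PhiP3 β (‖a‖ • e3) :=
    lintegral_congr fun a => PhiP3_eq_axis β a
  calc ENNReal.ofReal (β ^ 2 * zeroModeZ 3 β)
      = ENNReal.ofReal (β ^ 2) * ∫⁻ c, ENNReal.ofReal (zmI 3 β c) := by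
        rw [ENNReal.ofReal_mul (sq_nonneg _), ofReal_zeroModeZ 3 hβ.le]
    _ ≤ ENNReal.ofReal (β ^ 2) * (3 * ∫⁻ a, PhiP3 β a) := by gcongr
    _ = 3 * ∫⁻ a, ENNReal.ofReal (β ^ 2) * PhiP3 β (‖a‖ • e3) := by
        rw [lintegral_const_mul' _ _ ENNReal.ofReal_ne_top, hax]
        ring
    _ ≤ 3 * ∫⁻ a, KK2 * ENNReal.ofReal (Real.exp (-‖a‖ ^ 2 / 2) / ‖a‖ ^ 2) := by
        gcongr 3 * ?_; exact lintegral_mono_ae hpt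
    _ = B3 := by
        unfold B3 Wrad
        rw [lintegral_const_mul' _ _ KK2_ne_top, mul_assoc]

/-- ★★ **UNIFORM BOUND, real form**: `β²·Z₃(β) ≤ B₃.toReal` for every `β > 0`. [folklore] -/
theorem zeroModeZ_three_sq_mul_le {β : ℝ} (hβ : 0 < β) : β ^ 2 * zeroModeZ 3 β ≤ B3.toReal :=
  (ENNReal.ofReal_le_iff_le_toReal B3_lt_top.ne).1 (ofReal_sq_mul_zeroModeZ_three_le hβ)

end Summit.QuantumFields.YangMills.Theorems.ToronValleyVolume.ZeroMode

end
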